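import Literature.Analysis.FluidPDE.PassiveVectorTestOperator
import Literature.Analysis.FluidPDE.PassiveVectorTensor
import HarnessLib

/-!
# The damped weak operator of the TENSOR passive-vector equation on space–time test fields

Analysis/FluidPDE proof-support file (everything proved; no definitions, no named facts). Tensor twin
of `PassiveVectorTestOperator`: the `L²(μ_T)` bookkeeping for the damped weak operator
`L_𝔸 ψ := ∂ₜψ - ψ + (b·∇)ψ + 𝓛_𝔸^* ψ` (`𝓛_𝔸^* = viscAdj 𝔸`, Frisch's anisotropic eddy viscosity
(9.57), constant fourth-order tensor, no symmetry) acting on space–time test fields, for J.-L. Lions'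
existence theorem applied to the weak tensor passive-vector class `IsWeakTensorPassiveVectorOn`
(Lions–Magenes 1972, Chap. 3 §4.3, with `νΔ` replaced by `𝓛_𝔸^*`):
* `memLp_two_dampedOpT` — `L_𝔸ψ ∈ L²(μ_T)` for a test `ψ` and a bounded carrier;
* `undamped_weak_of_dampedT` — undamping `u = e^{t} v` (test with `e^{t}ψ`);
* `dampedOpT_add`, `dampedOpT_const_smul` — linearity in the test field.
The time-derivative and transport parts are those of the scalar file (reused); only the viscous part
changes (`isSpaceTimeTest_viscAdj`, `viscAdj_add_field`, `viscAdj_const_smul_field`).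

## References

* J.-L. Lions, E. Magenes, *Non-homogeneous boundary value problems and applications* I (1972),
  Chap. 3, §4.3. [`LionsMagenes1972`]
* U. Frisch, *Turbulence* (CUP 1995), §9.6.3 eq. (9.57) p. 233. [`Frisch1995Turbulence`]
* K. Yoshida, Y. Kaneda, Phys. Rev. E 63 (2000) 016308, §II eq. (4)–(5). [`YoshidaKaneda2000`]
-/

noncomputable section

open MeasureTheory Set Filter Function TopologicalSpace
open scoped ENNReal NNReal InnerProductSpace Topology

namespace Literature.Analysis.FluidPDE

namespace Torus

variable {d : Type*} [Fintype d] [DecidableEq d]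

/-! ## Test fields and their images under the damped operator are in `L²(μ_T)` -/

/-- **The image of a test field under the damped tensor operator is in `L²(μ_T)`**:
`(t,x) ↦ ∂ₜψ - ψ + (b·∇)ψ + 𝓛_𝔸^*ψ` for a space–time test `ψ` and a carrier bounded a.e. on `(0,T) × T^d`.
[cite: LionsMagenes1972, Chap. 3 §4.3] -/
theorem memLp_two_dampedOpT {T : ℝ} (𝔸 : Visc4 d) {b ψ : ℝ → UnitAddTorus d → EuclideanSpace ℝ d}
    (hψ : FunctionSpaces.Torus.IsSpaceTimeTest T ψ)
    (hbm : AEStronglyMeasurable (uncurry b) (((volume : Measure ℝ).restrict (Ioo 0 T)).prod volume)) {M : ℝ}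
    (hbM : ∀ᵐ p ∂(((volume : Measure ℝ).restrict (Ioo 0 T)).prod (volume : Measure (UnitAddTorus d))),
      ‖uncurry b p‖ ≤ M) :
    MemLp (fun p : ℝ × UnitAddTorus d => FunctionSpaces.Torus.timeDeriv ψ p.1 p.2 - ψ p.1 p.2 +
        FunctionSpaces.Torus.convect (b p.1) (ψ p.1) p.2 + viscAdj 𝔸 (ψ p.1) p.2) 2
      (((volume : Measure ℝ).restrict (Ioo 0 T)).prod volume) := by
  have h1 : MemLp (uncurry (FunctionSpaces.Torus.timeDeriv ψ)) 2 (((volume : Measure ℝ).restrict (Ioo 0 T)).prod volume) :=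
    hψ.timeDeriv.memLp_two_uncurry
  have h2 := hψ.memLp_two_uncurry
  have h3 := memLp_two_convect_test hψ hbm hbM
  have h4 : MemLp (uncurry fun t x => viscAdj 𝔸 (ψ t) x) 2 (((volume : Measure ℝ).restrict (Ioo 0 T)).prod volume) :=
    (isSpaceTimeTest_viscAdj 𝔸 hψ).memLp_two_uncurry
  exact ((h1.sub h2).add h3).add h4

/-! ## Undamping -/

omit [DecidableEq d] in
/-- Time derivative of `e^{t} • ψ`: `∂ₜ(e^{t}ψ) = e^{t}ψ + e^{t}∂ₜψ`. [folklore] -/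
private theorem timeDeriv_exp_smul_T1 {T : ℝ} {ψ : ℝ → UnitAddTorus d → EuclideanSpace ℝ d}
    (hψ : FunctionSpaces.Torus.IsSpaceTimeTest T ψ) (t : ℝ) (x : UnitAddTorus d) :
    FunctionSpaces.Torus.timeDeriv (fun t x => Real.exp t • ψ t x) t x =
      Real.exp t • ψ t x + Real.exp t • FunctionSpaces.Torus.timeDeriv ψ t x := by
  have hd : HasDerivAt (fun τ => ψ τ x) (FunctionSpaces.Torus.timeDeriv ψ t x) t := by
    have hdiff : DifferentiableAt ℝ (fun τ => ψ τ x) t := by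
      obtain ⟨y, rfl⟩ := FunctionSpaces.Torus.proj_surjective x
      have h : (fun τ : ℝ => ψ τ (FunctionSpaces.Torus.proj y)) = FunctionSpaces.Torus.stLift ψ ∘ fun τ : ℝ => (τ, y) := by
        funext τ; rfl
      rw [h]
      exact ((hψ.1.differentiable (by simp)).differentiableAt).comp t
        (differentiableAt_id.prodMk (differentiableAt_const _))
    exact hdiff.hasDerivAt
  have h := (Real.hasDerivAt_exp t).smul hd
  simp only [FunctionSpaces.Torus.timeDeriv] at h ⊢
  rw [show (fun τ => Real.exp τ • ψ τ x) = (Real.exp • fun τ => ψ τ x) from rfl, h.deriv, add_comm]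

omit [Fintype d] in
/-- `∂ᵢ (c f) = c ∂ᵢ f` for real functions on `T^d`. [folklore] -/
private theorem partialDeriv_const_mul_T1 (c : ℝ) (f : UnitAddTorus d → ℝ) (i : d) (x : UnitAddTorus d) :
    FunctionSpaces.Torus.partialDeriv i (fun y => c * f y) x = c * FunctionSpaces.Torus.partialDeriv i f x := by
  simp only [FunctionSpaces.Torus.partialDeriv, FunctionSpaces.Torus.lineDeriv, deriv_const_mul_field']

/-- A constant multiple of a divergence-free field is divergence free. [folklore] -/
private theorem isDivFree_const_smul_T1 {G : UnitAddTorus d → EuclideanSpace ℝ d}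
    (hG : FunctionSpaces.Torus.IsDivFree G) (c : ℝ) : FunctionSpaces.Torus.IsDivFree (c • G) := by
  intro x
  have h : ∀ i : d, FunctionSpaces.Torus.partialDeriv i (fun y => (c • G) y i) x =
      c * FunctionSpaces.Torus.partialDeriv i (fun y => G y i) x := by
    intro i
    have e : (fun y => (c • G) y i) = fun y => c * G y i := by
      funext y; simp [Pi.smul_apply, smul_eq_mul]
    rw [e, partialDeriv_const_mul_T1]
  unfold FunctionSpaces.Torus.divergence
  simp_rw [h]
  rw [← Finset.mul_sum]
  have h0 := hG x
  unfold FunctionSpaces.Torus.divergence at h0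
  rw [h0, mul_zero]

omit [DecidableEq d] in
/-- `(u·∇)(c • G) = c • (u·∇)G` for a `C¹` field. [folklore] -/
private theorem convect_const_smul_T1 {G : UnitAddTorus d → EuclideanSpace ℝ d} (hG : FunctionSpaces.Torus.IsContDiff 1 G)
    (c : ℝ) (u : UnitAddTorus d → EuclideanSpace ℝ d) (x : UnitAddTorus d) :
    FunctionSpaces.Torus.convect u (c • G) x = c • FunctionSpaces.Torus.convect u G x := by
  simp only [FunctionSpaces.Torus.convect]
  rw [FunctionSpaces.Torus.fderiv_const_smul hG]
  rfl

/-- **Undamping (tensor viscosity).** If `v` satisfies the damped weak identity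
`∫_{μ_T}⟪v, ∂ₜψ - ψ + (b·∇)ψ + 𝓛_𝔸^*ψ⟫ + ∫⟪w₀, ψ(0)⟫ = 0` for all divergence-free space–time tests `ψ`,
then `u = e^{t} v` satisfies the undamped one (test with `e^{t}ψ`). [cite: LionsMagenes1972, Chap. 3 §4.3] -/
theorem undamped_weak_of_dampedT {T : ℝ} (𝔸 : Visc4 d) {b : ℝ → UnitAddTorus d → EuclideanSpace ℝ d}
    {v : ℝ × UnitAddTorus d → EuclideanSpace ℝ d} {w₀ : UnitAddTorus d → EuclideanSpace ℝ d}
    (hdamped : ∀ ψ : ℝ → UnitAddTorus d → EuclideanSpace ℝ d, FunctionSpaces.Torus.IsSpaceTimeTest T ψ →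
      FunctionSpaces.Torus.IsDivFreeTest ψ →
      (∫ p, ⟪v p, FunctionSpaces.Torus.timeDeriv ψ p.1 p.2 - ψ p.1 p.2 +
          FunctionSpaces.Torus.convect (b p.1) (ψ p.1) p.2 + viscAdj 𝔸 (ψ p.1) p.2⟫_ℝ
          ∂(((volume : Measure ℝ).restrict (Ioo 0 T)).prod volume)) + ∫ x, ⟪w₀ x, ψ 0 x⟫_ℝ = 0)
    {ψ : ℝ → UnitAddTorus d → EuclideanSpace ℝ d} (hψ : FunctionSpaces.Torus.IsSpaceTimeTest T ψ)
    (hdiv : FunctionSpaces.Torus.IsDivFreeTest ψ) :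
    (∫ p, ⟪Real.exp p.1 • v p, FunctionSpaces.Torus.timeDeriv ψ p.1 p.2 +
        FunctionSpaces.Torus.convect (b p.1) (ψ p.1) p.2 + viscAdj 𝔸 (ψ p.1) p.2⟫_ℝ
        ∂(((volume : Measure ℝ).restrict (Ioo 0 T)).prod volume)) + ∫ x, ⟪w₀ x, ψ 0 x⟫_ℝ = 0 := by
  have hΨ := hψ.exp_smul
  have hΨdiv : FunctionSpaces.Torus.IsDivFreeTest (fun t x => Real.exp t • ψ t x) := fun t => by
    show FunctionSpaces.Torus.IsDivFree (Real.exp t • ψ t)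
    exact isDivFree_const_smul_T1 (hdiv t) _
  have key := hdamped _ hΨ hΨdiv
  have hψ1 : ∀ t, FunctionSpaces.Torus.IsContDiff 1 (ψ t) := fun t => (hψ.isSmooth_slice t).isContDiff (by simp)
  have hpt : ∀ p : ℝ × UnitAddTorus d,
      ⟪v p, FunctionSpaces.Torus.timeDeriv (fun t x => Real.exp t • ψ t x) p.1 p.2 - Real.exp p.1 • ψ p.1 p.2 +
          FunctionSpaces.Torus.convect (b p.1) ((fun t x => Real.exp t • ψ t x) p.1) p.2 +
          viscAdj 𝔸 ((fun t x => Real.exp t • ψ t x) p.1) p.2⟫_ℝ =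
        ⟪Real.exp p.1 • v p, FunctionSpaces.Torus.timeDeriv ψ p.1 p.2 +
          FunctionSpaces.Torus.convect (b p.1) (ψ p.1) p.2 + viscAdj 𝔸 (ψ p.1) p.2⟫_ℝ := by
    intro p
    rw [timeDeriv_exp_smul_T1 hψ, show ((fun t x => Real.exp t • ψ t x) p.1) = Real.exp p.1 • ψ p.1 from rfl,
      convect_const_smul_T1 (hψ1 p.1), viscAdj_const_smul_field 𝔸 (hψ.isSmooth_slice p.1)]
    rw [real_inner_smul_left, ← real_inner_smul_right]
    congr 1
    rw [smul_add, smul_add]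
    abel
  have e0 : (fun x => ⟪w₀ x, (fun t x => Real.exp t • ψ t x) 0 x⟫_ℝ) = fun x => ⟪w₀ x, ψ 0 x⟫_ℝ := by
    funext x
    simp
  rw [integral_congr_ae (ae_of_all _ hpt), e0] at key
  exact key

/-! ## Linearity of the damped operator in the test field -/

omit [DecidableEq d] in
/-- A space–time test field is differentiable in time at every point (slice of the smooth lift). [folklore] -/
private theorem hasDerivAt_slice_test_T1 {T : ℝ} {ψ : ℝ → UnitAddTorus d → EuclideanSpace ℝ d}
    (hψ : FunctionSpaces.Torus.IsSpaceTimeTest T ψ) (t : ℝ) (x : UnitAddTorus d) :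
    HasDerivAt (fun τ => ψ τ x) (FunctionSpaces.Torus.timeDeriv ψ t x) t := by
  have hdiff : DifferentiableAt ℝ (fun τ => ψ τ x) t := by
    obtain ⟨y, rfl⟩ := FunctionSpaces.Torus.proj_surjective x
    have h : (fun τ : ℝ => ψ τ (FunctionSpaces.Torus.proj y)) = FunctionSpaces.Torus.stLift ψ ∘ fun τ : ℝ => (τ, y) := by
      funext τ; rfl
    rw [h]
    exact ((hψ.1.differentiable (by simp)).differentiableAt).comp t
      (differentiableAt_id.prodMk (differentiableAt_const _))
  exact hdiff.hasDerivAt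

omit [DecidableEq d] in
/-- `∂ₜ(ψ + χ) = ∂ₜψ + ∂ₜχ` for space–time test fields. [folklore] -/
private theorem timeDeriv_add_test_T1 {T : ℝ} {ψ χ : ℝ → UnitAddTorus d → EuclideanSpace ℝ d}
    (hψ : FunctionSpaces.Torus.IsSpaceTimeTest T ψ) (hχ : FunctionSpaces.Torus.IsSpaceTimeTest T χ)
    (t : ℝ) (x : UnitAddTorus d) :
    FunctionSpaces.Torus.timeDeriv (ψ + χ) t x = FunctionSpaces.Torus.timeDeriv ψ t x + FunctionSpaces.Torus.timeDeriv χ t x := by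
  have h := (hasDerivAt_slice_test_T1 hψ t x).add (hasDerivAt_slice_test_T1 hχ t x)
  simp only [FunctionSpaces.Torus.timeDeriv] at h ⊢
  exact h.deriv

omit [DecidableEq d] in
/-- `∂ₜ(c • ψ) = c • ∂ₜψ` for a space–time test field. [folklore] -/
private theorem timeDeriv_const_smul_test_T1 {T : ℝ} {ψ : ℝ → UnitAddTorus d → EuclideanSpace ℝ d}
    (hψ : FunctionSpaces.Torus.IsSpaceTimeTest T ψ) (c : ℝ) (t : ℝ) (x : UnitAddTorus d) :
    FunctionSpaces.Torus.timeDeriv (c • ψ) t x = c • FunctionSpaces.Torus.timeDeriv ψ t x := by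
  have h := (hasDerivAt_slice_test_T1 hψ t x).const_smul c
  simp only [FunctionSpaces.Torus.timeDeriv] at h ⊢
  exact h.deriv

/-- **The damped tensor operator is additive in the test field**:
`L(ψ + χ) = Lψ + Lχ` pointwise, `Lψ = ∂ₜψ - ψ + (b·∇)ψ + 𝓛_𝔸^*ψ`. [cite: LionsMagenes1972, Chap. 3 §4.3] -/
theorem dampedOpT_add {T : ℝ} (𝔸 : Visc4 d) {b ψ χ : ℝ → UnitAddTorus d → EuclideanSpace ℝ d}
    (hψ : FunctionSpaces.Torus.IsSpaceTimeTest T ψ) (hχ : FunctionSpaces.Torus.IsSpaceTimeTest T χ)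
    (p : ℝ × UnitAddTorus d) :
    FunctionSpaces.Torus.timeDeriv (ψ + χ) p.1 p.2 - (ψ + χ) p.1 p.2 +
        FunctionSpaces.Torus.convect (b p.1) ((ψ + χ) p.1) p.2 + viscAdj 𝔸 ((ψ + χ) p.1) p.2 =
      (FunctionSpaces.Torus.timeDeriv ψ p.1 p.2 - ψ p.1 p.2 +
          FunctionSpaces.Torus.convect (b p.1) (ψ p.1) p.2 + viscAdj 𝔸 (ψ p.1) p.2) +
        (FunctionSpaces.Torus.timeDeriv χ p.1 p.2 - χ p.1 p.2 +
          FunctionSpaces.Torus.convect (b p.1) (χ p.1) p.2 + viscAdj 𝔸 (χ p.1) p.2) := by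
  have hψ1 : FunctionSpaces.Torus.IsContDiff 1 (ψ p.1) := (hψ.isSmooth_slice p.1).isContDiff (by simp)
  have hχ1 : FunctionSpaces.Torus.IsContDiff 1 (χ p.1) := (hχ.isSmooth_slice p.1).isContDiff (by simp)
  rw [timeDeriv_add_test_T1 hψ hχ, show (ψ + χ) p.1 = ψ p.1 + χ p.1 from rfl,
    viscAdj_add_field 𝔸 (hψ.isSmooth_slice p.1) (hχ.isSmooth_slice p.1)]
  simp only [FunctionSpaces.Torus.convect, Pi.add_apply]
  rw [FunctionSpaces.Torus.fderiv_add hψ1 hχ1]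
  simp only [FunLike.coe_add, Pi.add_apply]
  abel

/-- **The damped tensor operator is homogeneous in the test field**: `L(c • ψ) = c • Lψ` pointwise.
[cite: LionsMagenes1972, Chap. 3 §4.3] -/
theorem dampedOpT_const_smul {T : ℝ} (𝔸 : Visc4 d) {b ψ : ℝ → UnitAddTorus d → EuclideanSpace ℝ d}
    (hψ : FunctionSpaces.Torus.IsSpaceTimeTest T ψ) (c : ℝ) (p : ℝ × UnitAddTorus d) :
    FunctionSpaces.Torus.timeDeriv (c • ψ) p.1 p.2 - (c • ψ) p.1 p.2 +
        FunctionSpaces.Torus.convect (b p.1) ((c • ψ) p.1) p.2 + viscAdj 𝔸 ((c • ψ) p.1) p.2 =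
      c • (FunctionSpaces.Torus.timeDeriv ψ p.1 p.2 - ψ p.1 p.2 +
        FunctionSpaces.Torus.convect (b p.1) (ψ p.1) p.2 + viscAdj 𝔸 (ψ p.1) p.2) := by
  have hψ1 : FunctionSpaces.Torus.IsContDiff 1 (ψ p.1) := (hψ.isSmooth_slice p.1).isContDiff (by simp)
  rw [timeDeriv_const_smul_test_T1 hψ, show (c • ψ) p.1 = c • ψ p.1 from rfl, convect_const_smul_T1 hψ1,
    viscAdj_const_smul_field 𝔸 (hψ.isSmooth_slice p.1)]
  simp only [Pi.smul_apply, smul_add, smul_sub]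

end Torus

end Literature.Analysis.FluidPDE

end
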